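import Summits.CriticalPhenomena.PercolationContinuityZ3.Theorems.PercNearOneGluingNoHeavyLowerTailThreePointVarianceGladkovRegime
import HarnessLib

/-!
# The three-point variance row `(3PT)` in the SYMMETRIC Gladkov regime — every finite weighted graph

Support file for crux `stmt-CriticalPhenomena-4575` (`NoHeavyLowerTail`), seat `prim-l12-p1` gen 17
(`--supports stmt-CriticalPhenomena-4575`); continuation of `…ThreePointVarianceGladkovRegime` (same notation:
`x, s, t, u, q` the five cells of `{a,b,c}`, `θ = μ(a↔b) = x+s`, `1−θ = q+t+u`).  Memo
`run/shared/lean/prim/prim-l12/FROM-prim-l12-p1-g17-GLADKOV-REGIME.md` §1.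

`(N4)`: `qθ ≤ qs/(q+s) + qt/(q+t) + u(1−θ)` — Gladkov's Lemma 1.2 at `a` [cite: Gladkov2024, Lemma 1.2], weakened by
`θ ≤ 1 − μ(a isolated)`; and its `a ↔ b` mirror `qθ ≤ qs/(q+s) + qu/(q+u) + t(1−θ)`.  Averaging the two:

  `(3PT)` holds whenever `q t/(q+t) + q u/(q+u) ≤ 2 s²/(q+s) + (t+u)(1−θ)`   (`threePointVariance_of_regime_sum`),

a hypothesis symmetric in `a, b`, neither weaker nor stronger than the one-sided regimes of the previous file.
Numerically it holds on every realizable law tested (memo §2: 0 of 3·10⁵ weightings on `K₄, K₅, K₃,₃+c, …`, whereas each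
one-sided hypothesis fails on ≈ 1.5 % of them; 0 exceptions on ≈ 200 hill-climbed graphs and on the hub families).
Nothing is claimed outside the hypothesis.

Main results: `n4_algebra`, `regime_sum_algebra`, `threePointVariance_of_regime_sum`.
-/

namespace Summit.CriticalPhenomena.PercolationContinuityZ3.Theorems.ThreePointVarianceGladkovRegime

open MeasureTheory Set
open Literature.Probability.Percolation Literature.Probability.LatticeModels

variable {V : Type*} [Fintype V]

/-- **`(N4)` algebra**: for nonnegative `s t u q` and `θ` with `θ + t + u + q = 1`, Lemma 1.2 at `a`
(`q²/(q+t) + q²/(q+s) ≤ q + (q+u)²`) gives `qθ ≤ qs/(q+s) + qt/(q+t) + u(1−θ)` (total division). [this work] -/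
theorem n4_algebra {θ s t u q : ℝ} (hs : 0 ≤ s) (ht : 0 ≤ t) (hu : 0 ≤ u) (hq : 0 ≤ q)
    (hsum : θ + t + u + q = 1)
    (hL : q ^ 2 / (q + t) + q ^ 2 / (q + s) ≤ q + (q + u) ^ 2) :
    q * θ ≤ q * s / (q + s) + q * t / (q + t) + u * (1 - θ) := by
  by_cases hC : q + s = 0
  · have hq0 : q = 0 := by linarith
    rw [hq0]
    simp only [zero_mul, zero_div, zero_add]
    exact mul_nonneg hu (by linarith)
  by_cases hB : q + t = 0
  · have hq0 : q = 0 := by linarith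
    rw [hq0]
    simp only [zero_mul, zero_div, zero_add]
    exact mul_nonneg hu (by linarith)
  have hC' : 0 < q + s := lt_of_le_of_ne (add_nonneg hq hs) (Ne.symm hC)
  have hB' : 0 < q + t := lt_of_le_of_ne (add_nonneg hq ht) (Ne.symm hB)
  have e1 : q ^ 2 / (q + s) = q - q * s / (q + s) := by
    rw [eq_sub_iff_add_eq, ← add_div, div_eq_iff (ne_of_gt hC')]
    ring
  have e2 : q ^ 2 / (q + t) = q - q * t / (q + t) := by
    rw [eq_sub_iff_add_eq, ← add_div, div_eq_iff (ne_of_gt hB')]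
    ring
  have h1 : q - (q + u) ^ 2 ≤ q * s / (q + s) + q * t / (q + t) := by
    rw [e1, e2] at hL
    linarith
  have hA : θ ≤ 1 - (q + u) := by linarith
  have h2 : (q + u) * θ ≤ (q + u) * (1 - (q + u)) := mul_le_mul_of_nonneg_left hA (add_nonneg hq hu)
  nlinarith [h1, h2]

/-- **The symmetric regime algebra**: `(N4)` at `a` and at `b` plus the symmetric hypothesis
`qt/(q+t) + qu/(q+u) ≤ 2s²/(q+s) + (t+u)(1−θ)` give `θ(1−θ) ≤ s + t + u`. [this work] -/
theorem regime_sum_algebra {θ s t u q : ℝ} (hs : 0 ≤ s) (ht : 0 ≤ t) (hu : 0 ≤ u) (hq : 0 ≤ q)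
    (hsum : θ + t + u + q = 1)
    (hLa : q ^ 2 / (q + t) + q ^ 2 / (q + s) ≤ q + (q + u) ^ 2)
    (hLb : q ^ 2 / (q + u) + q ^ 2 / (q + s) ≤ q + (q + t) ^ 2)
    (hR : q * t / (q + t) + q * u / (q + u) ≤ 2 * (s ^ 2 / (q + s)) + (t + u) * (1 - θ)) :
    θ * (1 - θ) ≤ s + t + u := by
  have h1θ : 1 - θ = q + t + u := by linarith
  have hsum' : θ + u + t + q = 1 := by linarith
  have ha := n4_algebra hs ht hu hq hsum hLa
  have hb := n4_algebra hs hu ht hq hsum' hLb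
  -- `qs/(q+s) + s²/(q+s) = s` (also when `q + s = 0`, since then `q = s = 0`)
  have e3 : q * s / (q + s) + s ^ 2 / (q + s) = s := by
    by_cases hC : q + s = 0
    · have hq0 : q = 0 := by linarith
      have hs0 : s = 0 := by linarith
      rw [hq0, hs0]
      simp
    · rw [← add_div, div_eq_iff hC]
      ring
  have h4 : q * θ ≤ s + (t + u) * (1 - θ) := by nlinarith [ha, hb, hR, e3]
  have h5 : θ * (1 - θ) = q * θ + (t + u) * θ := by
    rw [h1θ]
    ring
  rw [h5]
  nlinarith [h4]

/-- **`(3PT)` in the symmetric Gladkov regime, on every finite weighted graph.**  For `μ = prodBernoulli w` and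
vertices `a b c` (cells as above): if
`q·t/μ(b isolated) + q·u/μ(a isolated) ≤ 2·s²/μ(c isolated) + (t+u)·μ(a↮b)`
then `μ(a↔b)·μ(a↮b) ≤ μ(a↔b, a↮c) + μ(a↔c, a↮b) + μ(b↔c, a↮b)`.
From Gladkov's Lemma 1.2 at `a` and at `b` [cite: Gladkov2024, Lemma 1.2]; hypothesis and corollary [this work]. -/
theorem threePointVariance_of_regime_sum (w : Sym2 V → unitInterval) (a b c : V)
    (hR : (prodBernoulli w).real ((openConn a b)ᶜ ∩ (openConn a c)ᶜ ∩ (openConn b c)ᶜ) *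
            (prodBernoulli w).real (openConn a c ∩ (openConn a b)ᶜ) /
            (prodBernoulli w).real ((openConn a b)ᶜ ∩ (openConn b c)ᶜ) +
          (prodBernoulli w).real ((openConn a b)ᶜ ∩ (openConn a c)ᶜ ∩ (openConn b c)ᶜ) *
            (prodBernoulli w).real (openConn b c ∩ (openConn a b)ᶜ) /
            (prodBernoulli w).real ((openConn a b)ᶜ ∩ (openConn a c)ᶜ) ≤
        2 * ((prodBernoulli w).real (openConn a b ∩ (openConn a c)ᶜ) ^ 2 /
            (prodBernoulli w).real ((openConn a c)ᶜ ∩ (openConn b c)ᶜ)) +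
          ((prodBernoulli w).real (openConn a c ∩ (openConn a b)ᶜ) +
              (prodBernoulli w).real (openConn b c ∩ (openConn a b)ᶜ)) * (prodBernoulli w).real (openConn a b)ᶜ) :
    (prodBernoulli w).real (openConn a b) * (prodBernoulli w).real (openConn a b)ᶜ ≤
      (prodBernoulli w).real (openConn a b ∩ (openConn a c)ᶜ) + (prodBernoulli w).real (openConn a c ∩ (openConn a b)ᶜ) +
        (prodBernoulli w).real (openConn b c ∩ (openConn a b)ᶜ) := by
  classical
  obtain ⟨_, _, cA, u₃, u₂, u₁, cAB, cAC, cBC, cQ⟩ := cells_eq w a b c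
  have hLa := gladkov2024_lemma_1_2_prodBernoulli w a b c
  -- Lemma 1.2 at `b`, transported to the `(a, b, c)` events
  have hLb0 := gladkov2024_lemma_1_2_prodBernoulli w b a c
  have e1 : (openConn b a : Set (BondConfig V)) = openConn a b := by
    ext ω
    exact ⟨fun h' => SimpleGraph.Reachable.symm h', fun h' => SimpleGraph.Reachable.symm h'⟩
  have e3 : ((openConn b a)ᶜ ∩ (openConn b c)ᶜ ∩ (openConn a c)ᶜ : Set (BondConfig V)) =
      (openConn a b)ᶜ ∩ (openConn a c)ᶜ ∩ (openConn b c)ᶜ := by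
    rw [e1]
    ext ω
    simp only [Set.mem_inter_iff, Set.mem_compl_iff]
    tauto
  have e6 : ((openConn b a)ᶜ ∩ (openConn a c)ᶜ : Set (BondConfig V)) = (openConn a b)ᶜ ∩ (openConn a c)ᶜ := by
    rw [e1]
  have e7 : ((openConn b c)ᶜ ∩ (openConn a c)ᶜ : Set (BondConfig V)) = (openConn a c)ᶜ ∩ (openConn b c)ᶜ :=
    Set.inter_comm _ _
  have e8 : ((openConn b a)ᶜ ∩ (openConn b c)ᶜ : Set (BondConfig V)) = (openConn a b)ᶜ ∩ (openConn b c)ᶜ := by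
    rw [e1]
  rw [e3, e6, e7, e8] at hLb0
  -- nonnegativity of the cells
  have hs : 0 ≤ (prodBernoulli w).real (openConn a b ∩ (openConn a c)ᶜ) := measureReal_nonneg
  have ht : 0 ≤ (prodBernoulli w).real (openConn a c ∩ (openConn a b)ᶜ) := measureReal_nonneg
  have hu : 0 ≤ (prodBernoulli w).real (openConn b c ∩ (openConn a b)ᶜ) := measureReal_nonneg
  have hq : 0 ≤ (prodBernoulli w).real ((openConn a b)ᶜ ∩ (openConn a c)ᶜ ∩ (openConn b c)ᶜ) :=
    measureReal_nonneg
  rw [u₃] at hs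
  rw [u₂] at ht
  rw [u₁] at hu
  rw [cQ] at hq
  rw [cA, u₃, u₂, u₁, cAC, cAB, cBC, cQ] at hR
  rw [cAB, cAC, cBC, cQ] at hLa
  rw [cAC, cBC, cAB, cQ] at hLb0
  rw [cA, u₃, u₂, u₁]
  set x := (prodBernoulli w).real (openConn a b) with hx
  set y := (prodBernoulli w).real (openConn a c) with hy
  set z := (prodBernoulli w).real (openConn b c) with hz
  set tt := (prodBernoulli w).real (openConn a b ∩ openConn a c) with htt
  have eB : 1 - x - z + tt = (1 - x - y - z + 2 * tt) + (y - tt) := by ring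
  have eC : 1 - y - z + tt = (1 - x - y - z + 2 * tt) + (x - tt) := by ring
  have eA : 1 - x - y + tt = (1 - x - y - z + 2 * tt) + (z - tt) := by ring
  rw [eB, eC, eA] at hLa hR hLb0
  have key := regime_sum_algebra (θ := x) (s := x - tt) (t := y - tt) (u := z - tt) (q := 1 - x - y - z + 2 * tt)
    hs ht hu hq (by ring) hLa hLb0 hR
  linarith [key]

end Summit.CriticalPhenomena.PercolationContinuityZ3.Theorems.ThreePointVarianceGladkovRegime
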